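import Mathlib
import Summits.Ventures.PercRepro2.Defs
import Summits.Ventures.PercRepro2.Independence
import Summits.Ventures.PercRepro2.Harris
import Summits.Ventures.PercRepro2.Graph
import Summits.Ventures.PercRepro2.Events
import Summits.Ventures.PercRepro2.Induced
import Summits.Ventures.PercRepro2.BHKAvoid
import Summits.Ventures.PercRepro2.BHKEvents
import Summits.Ventures.PercRepro2.ZCPendantSecondOrder
import Summits.Ventures.PercRepro2.CDZero
import Summits.Ventures.PercRepro2.CDRequired
import Summits.Ventures.PercRepro2.CaseOnePendant
import Summits.Ventures.PercRepro2.HullTree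
import Summits.Ventures.PercRepro2.GateCylinder
import Summits.Ventures.PercRepro2.GateForest

/-!
# Row 2′CD on the cylinder class — a unique `a₁`–`a₃` path of bridges; every forest
(blind cell PercRepro2, mine-a g33; MINE-A.md §88)

Two roots `a₁, a₂`, marks `a₃, o`; `Q = {a₁ ↮ a₂}`, `e = {a₃ ∈ C₁}`, `f = {o ∈ C₂}`, `U = {C₁ ∈ 𝓔}`
for an up-set `𝓔`, `N = {a₃ ∉ C₁ ∪ C₂}`, `oU = {o ∈ C₁ ∪ C₂}`.  Row 2′CD in cleared form
(`CDRequired.cd_of_required_anticorr`) is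

  `(CD)   P(Q N) · (P(Q) P(Q U e f) − P(Q U) P(Q e f)) ≤ P(Q N oU) · (P(Q) P(Q U e) − P(Q U) P(Q e))`,

and by the identity `CDRequired.cd_identity` it holds whenever `U` and `{o ∈ C₂}` are anti-correlated
in the `a₃`-REQUIRED world: `P(Q U e f) · P(Q e) ≤ P(Q U e) · P(Q e f)`.

**The cylinder class.** Suppose the connection event `e = {a₁ ↔ a₃}` is a CYLINDER: for a finset `B`
of edges, `a₃ ∈ C₁ ⟺ every edge of B is open` (`connEvent ends a₁ a₃ = GateCylinder.cylinder B`).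
This is the case exactly when `a₁` and `a₃` are joined by a unique path all of whose edges are
bridges — on every forest (`GateForest.conn_iff_cylinder`, mine-c g8), and for `a₃` a leaf at `a₁`
(`B = {e₀}`, the class of `CaseOnePendant` / Theorem A).  Then conditioning on `e` is FORCING the
cylinder open: for every event `A`,

  `P_p(A ∩ cylinder B) = (∏ b ∈ B, p b) · P_{forceOpen p B}(A)`     (`GateCylinder.prob_inter_cylinder`),

so the `a₃`-required world is the plain `Q`-world of the forced weight vector, and there the van den
Berg–Häggström–Kahn cross-cluster inequality (BHK06 Thm 1.4, `bhk_cross_cluster`: given `a₁ ↮ a₂`, an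
up-set of `C₁` and `{o ∈ C₂}` are negatively correlated) is EXACTLY the required anti-correlation
(`required_anticorr_of_cylinder`).  Hence **row 2′CD holds for every up-set and every weight vector on
the cylinder class** (`cd_of_cylinder`), in particular **on every forest** (`cd_of_isForest`: `ends`
injective and the all-open graph acyclic, no other hypothesis — the first tree theorem of the row) and
for `a₃` a leaf at `a₁` (`cd_of_leaf_at_root`, a second proof of mine-a g11's Theorem A /
`SLevel.cd_of_leaf`).  Outside the class `{a₃ ∈ C₁}` is not a cylinder, the required-world law is a
product law conditioned on an up-set, and the anti-correlation can fail (≈ 1 % of random cells,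
MINE-A.md §86.1, §88.2) — the row is then carried by the identity's other term.  No definition; one seat.
-/

namespace Summit.Ventures.PercRepro2

namespace CDCylinder

section Main

variable {V : Type*} {E : Type*} [Fintype E] [DecidableEq E] [Fintype V] [DecidableEq V]
  {R : Type*} [Field R] [LinearOrder R] [IsStrictOrderedRing R]

omit [Fintype E] [DecidableEq E] [Fintype V] [DecidableEq V] in
/-- Scaling both sides of a product inequality by the square of a nonnegative number. -/
lemma mul_mul_le_mul_mul {π x y z w : R} (hπ : 0 ≤ π) (h : x * y ≤ z * w) :
    π * x * (π * y) ≤ π * z * (π * w) := by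
  calc π * x * (π * y) = (π * π) * (x * y) := by ring
    _ ≤ (π * π) * (z * w) := mul_le_mul_of_nonneg_left h (mul_nonneg hπ hπ)
    _ = π * z * (π * w) := by ring

/-- **The required-world anti-correlation on the cylinder class.** If `{a₃ ∈ C₁} = cylinder B`, then
`P(Q U e f) · P(Q e) ≤ P(Q U e) · P(Q e f)`: force `B` open (`GateCylinder.prob_inter_cylinder`) and
apply BHK06 Thm 1.4 (`bhk_cross_cluster`) in the forced world. -/
theorem required_anticorr_of_cylinder (p : E → R) (hp : IsProbVec p) (ends : E → Sym2 V)
    (a₁ a₂ a₃ o : V) {𝓔 : Set (Set V)} (h𝓔 : IsUpperSet 𝓔) {B : Finset E}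
    (hB : connEvent ends a₁ a₃ = GateCylinder.cylinder B) :
    prob p ((connEvent ends a₁ a₂)ᶜ ∩ clusterInEvent ends a₁ 𝓔 ∩ connEvent ends a₁ a₃ ∩
          connEvent ends a₂ o) * prob p ((connEvent ends a₁ a₂)ᶜ ∩ connEvent ends a₁ a₃) ≤
      prob p ((connEvent ends a₁ a₂)ᶜ ∩ clusterInEvent ends a₁ 𝓔 ∩ connEvent ends a₁ a₃) *
        prob p ((connEvent ends a₁ a₂)ᶜ ∩ connEvent ends a₁ a₃ ∩ connEvent ends a₂ o) := by
  -- BHK06 Thm 1.4 in the forced world `forceOpen p B`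
  have key := bhk_cross_cluster (GateCylinder.forceOpen p B) (GateCylinder.isProbVec_forceOpen hp B)
    ends a₁ a₂ h𝓔 (ZCPendant.isUpperSet_mem_o (V := V) o)
  rw [ZCPendant.clusterInEvent_mem_o_eq] at key
  -- the four events, with the cylinder split off
  have e1 : (connEvent ends a₁ a₂)ᶜ ∩ clusterInEvent ends a₁ 𝓔 ∩ connEvent ends a₁ a₃ ∩
      connEvent ends a₂ o =
      (clusterInEvent ends a₁ 𝓔 ∩ connEvent ends a₂ o ∩ (connEvent ends a₁ a₂)ᶜ) ∩
        GateCylinder.cylinder B := by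
    rw [hB]; ext ω; simp only [Set.mem_inter_iff]; tauto
  have e2 : (connEvent ends a₁ a₂)ᶜ ∩ connEvent ends a₁ a₃ =
      (connEvent ends a₁ a₂)ᶜ ∩ GateCylinder.cylinder B := by
    rw [hB]
  have e3 : (connEvent ends a₁ a₂)ᶜ ∩ clusterInEvent ends a₁ 𝓔 ∩ connEvent ends a₁ a₃ =
      (clusterInEvent ends a₁ 𝓔 ∩ (connEvent ends a₁ a₂)ᶜ) ∩ GateCylinder.cylinder B := by
    rw [hB]; ext ω; simp only [Set.mem_inter_iff]; tauto
  have e4 : (connEvent ends a₁ a₂)ᶜ ∩ connEvent ends a₁ a₃ ∩ connEvent ends a₂ o =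
      (connEvent ends a₂ o ∩ (connEvent ends a₁ a₂)ᶜ) ∩ GateCylinder.cylinder B := by
    rw [hB]; ext ω; simp only [Set.mem_inter_iff]; tauto
  rw [e1, e3, e4, e2, GateCylinder.prob_inter_cylinder, GateCylinder.prob_inter_cylinder,
    GateCylinder.prob_inter_cylinder, GateCylinder.prob_inter_cylinder]
  have hπ : 0 ≤ ∏ b ∈ B, p b := Finset.prod_nonneg fun b _ => hp.nonneg b
  exact mul_mul_le_mul_mul hπ key

/-- **Row 2′CD on the cylinder class.** If `{a₃ ∈ C₁} = cylinder B` for a finset `B` of edges (a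
unique `a₁`–`a₃` path of bridges), then for every up-set `𝓔` of vertex sets and every admissible
weight vector,
`P(Q N)·(P(Q)P(Q U e f) − P(Q U)P(Q e f)) ≤ P(Q N oU)·(P(Q)P(Q U e) − P(Q U)P(Q e))`. -/
theorem cd_of_cylinder (p : E → R) (hp : IsProbVec p) (ends : E → Sym2 V) (a₁ a₂ a₃ o : V)
    {𝓔 : Set (Set V)} (h𝓔 : IsUpperSet 𝓔) {B : Finset E}
    (hB : connEvent ends a₁ a₃ = GateCylinder.cylinder B) :
    let Q := (connEvent ends a₁ a₂)ᶜ
    let U := clusterInEvent ends a₁ 𝓔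
    let e := connEvent ends a₁ a₃
    let f := connEvent ends a₂ o
    let N := (connEvent ends a₁ a₃)ᶜ ∩ (connEvent ends a₂ a₃)ᶜ
    let oU := connEvent ends a₁ o ∪ connEvent ends a₂ o
    prob p (Q ∩ N) * (prob p Q * prob p (Q ∩ U ∩ e ∩ f) - prob p (Q ∩ U) * prob p (Q ∩ e ∩ f)) ≤
      prob p (Q ∩ N ∩ oU) * (prob p Q * prob p (Q ∩ U ∩ e) - prob p (Q ∩ U) * prob p (Q ∩ e)) :=
  CDRequired.cd_of_required_anticorr p hp ends a₁ a₂ a₃ o h𝓔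
    (required_anticorr_of_cylinder p hp ends a₁ a₂ a₃ o h𝓔 hB)

omit [Fintype E] [DecidableEq E] [Fintype V] [DecidableEq V] in
/-- A leaf `a₃` at `a₁` through `e₀` is the cylinder `B = {e₀}`. -/
lemma connEvent_eq_cylinder_singleton_of_leaf {ends : E → Sym2 V} {a₁ a₃ : V} {e₀ : E}
    (hl : CaseOne.IsLeafAt ends a₁ a₃ e₀) :
    connEvent ends a₁ a₃ = GateCylinder.cylinder {e₀} := by
  rw [CaseOne.connEvent_leaf_eq_openEdge hl]
  ext ω
  simp [GateCylinder.cylinder, openEdge]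

/-- **Row 2′CD when `a₃` is a leaf at `a₁`** — the one-edge cylinder `B = {e₀}` (a second proof of
mine-a g11's Theorem A, `SLevel.cd_of_leaf`, in the cleared vocabulary of `CDRequired`). -/
theorem cd_of_leaf_at_root (p : E → R) (hp : IsProbVec p) (ends : E → Sym2 V) (a₁ a₂ a₃ o : V)
    {𝓔 : Set (Set V)} (h𝓔 : IsUpperSet 𝓔) {e₀ : E} (hl : CaseOne.IsLeafAt ends a₁ a₃ e₀) :
    let Q := (connEvent ends a₁ a₂)ᶜ
    let U := clusterInEvent ends a₁ 𝓔
    let e := connEvent ends a₁ a₃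
    let f := connEvent ends a₂ o
    let N := (connEvent ends a₁ a₃)ᶜ ∩ (connEvent ends a₂ a₃)ᶜ
    let oU := connEvent ends a₁ o ∪ connEvent ends a₂ o
    prob p (Q ∩ N) * (prob p Q * prob p (Q ∩ U ∩ e ∩ f) - prob p (Q ∩ U) * prob p (Q ∩ e ∩ f)) ≤
      prob p (Q ∩ N ∩ oU) * (prob p Q * prob p (Q ∩ U ∩ e) - prob p (Q ∩ U) * prob p (Q ∩ e)) :=
  cd_of_cylinder p hp ends a₁ a₂ a₃ o h𝓔 (connEvent_eq_cylinder_singleton_of_leaf hl)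

omit [DecidableEq E] [Fintype V] in
/-- On a forest, `{a₁ ↔ a₃}` is the cylinder of the unique `a₁`–`a₃` path of the all-open graph
(`GateForest.conn_iff_cylinder`, as an equality of events). -/
lemma connEvent_eq_cylinder_of_isForest {ends : E → Sym2 V} (hF : Hull.IsForest ends) {a₁ a₃ : V}
    (q : (openGraph ends (fun _ => true)).Path a₁ a₃) :
    connEvent ends a₁ a₃ = GateCylinder.cylinder (GateForest.edgeFinset ends q.1) := by
  ext ω
  exact GateForest.conn_iff_cylinder hF q ω

omit [Fintype E] [DecidableEq E] [Fintype V] [DecidableEq V] in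
/-- If `a₁` and `a₃` are not joined at all in the all-open graph, `{a₁ ↔ a₃}` is empty. -/
lemma connEvent_eq_empty_of_not_reachable {ends : E → Sym2 V} {a₁ a₃ : V}
    (h : ¬ (openGraph ends (fun _ => true)).Reachable a₁ a₃) :
    connEvent ends a₁ a₃ = ∅ := by
  ext ω
  simp only [mem_connEvent, Set.mem_empty_iff_false, iff_false]
  intro hc
  exact h (SimpleGraph.Reachable.mono (openGraph_mono (Hull.le_allOpen ω)) hc)

/-- **Row 2′CD on every forest.** If `ends` is a forest (`Hull.IsForest`: no parallel edges, the graph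
of all edges acyclic), then for every placement of `a₁, a₂, a₃, o`, every up-set `𝓔` and every
admissible weight vector the row holds: `a₁ ↔ a₃` is the cylinder of the unique path when the two are
joined (`cd_of_cylinder`), and the `a₃`-required events are empty when they are not. -/
theorem cd_of_isForest (p : E → R) (hp : IsProbVec p) {ends : E → Sym2 V} (hF : Hull.IsForest ends)
    (a₁ a₂ a₃ o : V) {𝓔 : Set (Set V)} (h𝓔 : IsUpperSet 𝓔) :
    let Q := (connEvent ends a₁ a₂)ᶜ
    let U := clusterInEvent ends a₁ 𝓔
    let e := connEvent ends a₁ a₃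
    let f := connEvent ends a₂ o
    let N := (connEvent ends a₁ a₃)ᶜ ∩ (connEvent ends a₂ a₃)ᶜ
    let oU := connEvent ends a₁ o ∪ connEvent ends a₂ o
    prob p (Q ∩ N) * (prob p Q * prob p (Q ∩ U ∩ e ∩ f) - prob p (Q ∩ U) * prob p (Q ∩ e ∩ f)) ≤
      prob p (Q ∩ N ∩ oU) * (prob p Q * prob p (Q ∩ U ∩ e) - prob p (Q ∩ U) * prob p (Q ∩ e)) := by
  intro Q U e f N oU
  by_cases hr : (openGraph ends (fun _ => true)).Reachable a₁ a₃
  · obtain ⟨w⟩ := hr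
    exact cd_of_cylinder p hp ends a₁ a₂ a₃ o h𝓔 (connEvent_eq_cylinder_of_isForest hF w.toPath)
  · have he : connEvent ends a₁ a₃ = ∅ := connEvent_eq_empty_of_not_reachable hr
    simp only [Q, U, e, f, N, oU, he, Set.inter_empty, Set.empty_inter, prob_empty, mul_zero,
      sub_zero, le_refl]

end Main

end CDCylinder

end Summit.Ventures.PercRepro2
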